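import Mathlib.Data.Nat.Prime.Basic
import Mathlib.Algebra.Group.Nat.Even
import Mathlib.Algebra.NeZero
import Mathlib.Tactic.NormNum.Prime
import HarnessLib

/-!
# REVIEW-RUNBOOK sanity lemmas — the numeric side conditions of the Fermat-cycles statements are
# jointly met (client `pub-hfermat` of the ops review-runbook generator)

Card (2)(b) («non-vacuity») of `run/shared/lean/pub/pub-hfermat/REVIEW-RUNBOOK.md`.  Three statements
carry numeric side conditions on their parameters only (library-phrased: `NeZero`, `≤`, `Even`,
`Nat.Prime`); a reader settles them by inspection, this file settles them by `decide` / `norm_num` as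
closed theorems `∃ objects, h₁ ∧ … ∧ hₙ` (the shape the generator's probe matches), at the FIRST
admissible parameters of each statement:

* `AokiTheoremA.theoremA` (`{m} [NeZero m] (h2 : 2 ≤ m) {n} (hn : Even n) (hn2 : 2 ≤ n)`): `m = 5`
  (a prime degree — the branch `Nat.Prime m` of the conclusion), `n = 2`;
* `Shioda1982.tabelleOneCompleteAt_of_le_ninety` (`(N) [NeZero N] (h2 : 2 ≤ N) (h : N ≤ 90)`): `N = 5`;
* `Shioda1982.card_hodgeQuadruples_sixPrime` (`{m p} [NeZero m] (hm : m = 6 * p) (hp : p.Prime)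
  (h17 : 17 ≤ p)`): `p = 17`, `m = 102` — the first member of the `6p` family.

Review evidence only (topic `Runbook/` module, no item); no definitions, no `sorry`, standard axioms.
-/

namespace Summit.HodgeConjecture.FermatCycles.Runbook

/-- (b) **The four side conditions of `AokiTheoremA.theoremA` hold together**: `m = 5` (`NeZero 5`,
`2 ≤ 5`), `n = 2` (even, `2 ≤ 2`). [folklore] -/
theorem theoremA_hypotheses : ∃ m n : ℕ, NeZero m ∧ 2 ≤ m ∧ Even n ∧ 2 ≤ n :=
  ⟨5, 2, ⟨by decide⟩, by decide, ⟨1, rfl⟩, le_rfl⟩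

/-- (b) **The three side conditions of `Shioda1982.tabelleOneCompleteAt_of_le_ninety` hold together**:
`N = 5` (`NeZero 5`, `2 ≤ 5 ≤ 90`). [folklore] -/
theorem tabelleOneCompleteAt_hypotheses : ∃ N : ℕ, NeZero N ∧ 2 ≤ N ∧ N ≤ 90 :=
  ⟨5, ⟨by decide⟩, by decide, by decide⟩

/-- (b) **The four side conditions of `Shioda1982.card_hodgeQuadruples_sixPrime` hold together**:
`m = 102 = 6 · 17` (`NeZero 102`), `p = 17` prime, `17 ≤ 17`. [folklore] -/
theorem card_hodgeQuadruples_sixPrime_hypotheses :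
    ∃ m p : ℕ, NeZero m ∧ m = 6 * p ∧ Nat.Prime p ∧ 17 ≤ p :=
  ⟨102, 17, ⟨by decide⟩, rfl, by norm_num, le_rfl⟩

end Summit.HodgeConjecture.FermatCycles.Runbook
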